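import Summits.CriticalPhenomena.PercolationContinuityZ3.Theorems.PercNearOneGluingNoHeavyLowerTailKnQuestion8CoefficientwiseZoneFlip
import HarnessLib

/-!
# The second one-edge reduction of coefficientwise conditional association: CW-PA ≥ CROSS (Harris on the zone cells of `z`)

Support file (`--supports stmt-CriticalPhenomena-4575`, closed), prover `prim-cplus-coupling` (gen 26).  No definitions, no notations, no named facts, no sorries;
standard axioms.  Memo `prim-cplus-coupling/A5-COUPLING-gen26.md` §5.6 (the cube of the eight correlation sums).  Companions: `…CoefficientwiseZoneFlip` (the
involution `P_z`, zone cells) and `…CoefficientwiseZoneFlipReduction` (Theorem K: CW-PA ≥ ½·DOM_z).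

With `S = {z ∉ C_x(s)} ∩ {z ∉ C_x(sᶜ)}`, `P_z s = s ∆ Q(s)` (recolour the edges meeting `C_z(s) ∪ C_z(sᶜ)`) and monotone `f, g`, the 'free flip'
`P_free s := (P_z s)ᶜ` recolours every edge OFF the zone of `z`; on a zone cell it is the complementation of the free coordinates, so Harris (prim-lf-2's
`fkg_cell`, through `cell_sum_mul_flip_le`) gives `Σ_S f(C_x s)·(g(C_x s) − g(C_x((P_z s)ᶜ))) ≥ 0`, i.e.
* **`Coefficientwise.cross_le_cwpa`** — `Σ_{s∈S} f(C_x s)·(g(C_x((P_z s)ᶜ)) − g(C_x sᶜ)) ≤ Σ_{s∈S} f(C_x s)·(g(C_x s) − g(C_x sᶜ))`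
  ('CW-PA = Harris term + CROSS'), and
* `Coefficientwise.cwpa_of_cross_nonneg` — `CROSS ≥ 0 ⟹ CW-PA ≥ 0`, where `CROSS(f,g) := Σ_S f(C_x s)·(g(C_x((P_z s)ᶜ)) − g(C_x sᶜ))` compares the red
  cluster of `x` after the free flip with the blue cluster of `x` (they differ only in which boundary of `z`'s two clusters is red).
Together with Theorem K these are the two 'one open edge' routes to CW-PA on the cube of memo §5.6 (census: CROSS ≥ 0 and DOM_z ≥ 0 on all graphs n ≤ 6,
m ≤ 6 and on random graphs / hypergraphs to 7 vertices).
[cite: KozmaNitzan2024, Questions 8–9 (§5.5 p. 36) (context: the Question-8 pocket covariance programme)]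
-/

namespace Summit.CriticalPhenomena.PercolationContinuityZ3.Theorems

open Finset Literature.Probability.Percolation

namespace Coefficientwise

variable {ι V : Type*} [Fintype ι] [DecidableEq ι]
variable (ends : ι → Sym2 V) (z : V)




open Classical in
/-- **CW-PA ≥ CROSS.**  For monotone `f, g`: `Σ_{s∈S} f(C_x s)·(g(C_x((P_z s)ᶜ)) − g(C_x sᶜ)) ≤ Σ_{s∈S} f(C_x s)·(g(C_x s) − g(C_x sᶜ))`; the difference
`Σ_S f(C_x s)·(g(C_x s) − g(C_x((P_z s)ᶜ)))` is nonnegative cell by cell (on a zone cell `{t | t ∩ Q = π}` one has `(P_z t)ᶜ = π ∪ (tᶜ ∖ Q)`, the flip of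
the free coordinates; `cell_sum_mul_flip_le`). [this work] -/
theorem cross_le_cwpa (x : V) (f g : Set V → ℝ) (hf : Monotone f) (hg : Monotone g) :
    ∑ s ∈ univ.filter (fun s : Finset ι => z ∉ (openCluster (ends '' (↑(s) : Set ι)) (x)) ∧ z ∉ (openCluster (ends '' (↑(sᶜ) : Set ι)) (x))),
        f (openCluster (ends '' (↑(s) : Set ι)) (x)) * (g (openCluster (ends '' (↑(((symmDiff (s) (Finset.univ.filter (fun i : ι => ∃ v, (v ∈ (openCluster (ends '' (↑(s) : Set ι)) (z)) ∨ v ∈ (openCluster (ends '' (↑((s)ᶜ) : Set ι)) (z))) ∧ v ∈ ends i))))ᶜ) : Set ι)) (x)) - g (openCluster (ends '' (↑(sᶜ) : Set ι)) (x))) ≤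
      ∑ s ∈ univ.filter (fun s : Finset ι => z ∉ (openCluster (ends '' (↑(s) : Set ι)) (x)) ∧ z ∉ (openCluster (ends '' (↑(sᶜ) : Set ι)) (x))),
        f (openCluster (ends '' (↑(s) : Set ι)) (x)) * (g (openCluster (ends '' (↑(s) : Set ι)) (x)) - g (openCluster (ends '' (↑(sᶜ) : Set ι)) (x))) := by
  -- notation
  set K : Finset ι → Set V := fun s => (openCluster (ends '' (↑(s) : Set ι)) (x)) with hK
  set F : Finset ι → ℝ := fun s => f (K s) with hF
  set G : Finset ι → ℝ := fun s => g (K s) with hG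
  set P : Finset ι → Finset ι := fun s => (symmDiff (s) (Finset.univ.filter (fun i : ι => ∃ v, (v ∈ (openCluster (ends '' (↑(s) : Set ι)) (z)) ∨ v ∈ (openCluster (ends '' (↑((s)ᶜ) : Set ι)) (z))) ∧ v ∈ ends i))) with hP
  set S : Finset (Finset ι) := univ.filter (fun s : Finset ι => z ∉ (openCluster (ends '' (↑(s) : Set ι)) (x)) ∧ z ∉ (openCluster (ends '' (↑(sᶜ) : Set ι)) (x))) with hS
  change ∑ s ∈ S, F s * (G (P s)ᶜ - G sᶜ) ≤ ∑ s ∈ S, F s * (G s - G sᶜ)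
  have hKmono : ∀ {s t : Finset ι}, s ⊆ t → K s ⊆ K t := fun hst => openCluster_image_mono ends hst x
  have hFm : Monotone F := fun s t hst => hf (hKmono hst)
  have hGm : Monotone G := fun s t hst => hg (hKmono hst)
  have mem_S : ∀ s, s ∈ S ↔ z ∉ (openCluster (ends '' (↑(s) : Set ι)) (x)) ∧ z ∉ (openCluster (ends '' (↑(sᶜ) : Set ι)) (x)) := fun s => by simp [hS]
  -- it suffices that the Harris term is nonnegative
  suffices h : 0 ≤ ∑ s ∈ S, F s * (G s - G (P s)ᶜ) by
    have e : ∀ s, F s * (G s - G sᶜ) = F s * (G s - G (P s)ᶜ) + F s * (G (P s)ᶜ - G sᶜ) := fun s => by ring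
    simp only [e, Finset.sum_add_distrib]
    linarith
  set key : Finset ι → Finset ι × Finset ι := fun s => ((Finset.univ.filter (fun i : ι => ∃ v, (v ∈ (openCluster (ends '' (↑(s) : Set ι)) (z)) ∨ v ∈ (openCluster (ends '' (↑((s)ᶜ) : Set ι)) (z))) ∧ v ∈ ends i)), s ∩ (Finset.univ.filter (fun i : ι => ∃ v, (v ∈ (openCluster (ends '' (↑(s) : Set ι)) (z)) ∨ v ∈ (openCluster (ends '' (↑((s)ᶜ) : Set ι)) (z))) ∧ v ∈ ends i))) with hkey
  rw [← Finset.sum_fiberwise_of_maps_to (s := S) (t := S.image key) (g := key)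
    (fun s hs => Finset.mem_image_of_mem key hs)]
  refine Finset.sum_nonneg fun k hk => ?_
  obtain ⟨s₀, hs₀S, rfl⟩ := Finset.mem_image.mp hk
  set B : Finset ι := (Finset.univ.filter (fun i : ι => ∃ v, (v ∈ (openCluster (ends '' (↑(s₀) : Set ι)) (z)) ∨ v ∈ (openCluster (ends '' (↑((s₀)ᶜ) : Set ι)) (z))) ∧ v ∈ ends i)) with hB
  set π : Finset ι := s₀ ∩ B with hπ
  have hπB : π ⊆ B := Finset.inter_subset_right
  have fiber_eq : S.filter (fun t => key t = key s₀) = univ.filter (fun t : Finset ι => t ∩ B = π) := by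
    ext t
    simp only [Finset.mem_filter, Finset.mem_univ, true_and]
    constructor
    · rintro ⟨_, hkt⟩
      have h1 : (Finset.univ.filter (fun i : ι => ∃ v, (v ∈ (openCluster (ends '' (↑(t) : Set ι)) (z)) ∨ v ∈ (openCluster (ends '' (↑((t)ᶜ) : Set ι)) (z))) ∧ v ∈ ends i)) = B := (Prod.ext_iff.mp hkt).1
      have h2 : t ∩ (Finset.univ.filter (fun i : ι => ∃ v, (v ∈ (openCluster (ends '' (↑(t) : Set ι)) (z)) ∨ v ∈ (openCluster (ends '' (↑((t)ᶜ) : Set ι)) (z))) ∧ v ∈ ends i)) = s₀ ∩ (Finset.univ.filter (fun i : ι => ∃ v, (v ∈ (openCluster (ends '' (↑(s₀) : Set ι)) (z)) ∨ v ∈ (openCluster (ends '' (↑((s₀)ᶜ) : Set ι)) (z))) ∧ v ∈ ends i)) := (Prod.ext_iff.mp hkt).2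
      rw [h1] at h2
      exact h2
    · intro ht
      have hloc := zone_locality ends z s₀ t ht
      have hQt : (Finset.univ.filter (fun i : ι => ∃ v, (v ∈ (openCluster (ends '' (↑(t) : Set ι)) (z)) ∨ v ∈ (openCluster (ends '' (↑((t)ᶜ) : Set ι)) (z))) ∧ v ∈ ends i)) = B := by
        rw [hB]; ext i
        simp only [Finset.mem_filter, Finset.mem_univ, true_and, hloc.1, hloc.2]
      refine ⟨?_, ?_⟩
      · rw [mem_S]
        have h0 := (mem_S s₀).mp hs₀S
        constructor
        · intro hz
          have hx : x ∈ (openCluster (ends '' (↑(t) : Set ι)) (z)) := SimpleGraph.Reachable.symm hz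
          rw [hloc.1] at hx
          exact h0.1 (SimpleGraph.Reachable.symm hx)
        · intro hz
          have hx : x ∈ (openCluster (ends '' (↑(tᶜ) : Set ι)) (z)) := SimpleGraph.Reachable.symm hz
          rw [hloc.2] at hx
          exact h0.2 (SimpleGraph.Reachable.symm hx)
      · change ((Finset.univ.filter (fun i : ι => ∃ v, (v ∈ (openCluster (ends '' (↑(t) : Set ι)) (z)) ∨ v ∈ (openCluster (ends '' (↑((t)ᶜ) : Set ι)) (z))) ∧ v ∈ ends i)), t ∩ (Finset.univ.filter (fun i : ι => ∃ v, (v ∈ (openCluster (ends '' (↑(t) : Set ι)) (z)) ∨ v ∈ (openCluster (ends '' (↑((t)ᶜ) : Set ι)) (z))) ∧ v ∈ ends i))) = ((Finset.univ.filter (fun i : ι => ∃ v, (v ∈ (openCluster (ends '' (↑(s₀) : Set ι)) (z)) ∨ v ∈ (openCluster (ends '' (↑((s₀)ᶜ) : Set ι)) (z))) ∧ v ∈ ends i)), s₀ ∩ (Finset.univ.filter (fun i : ι => ∃ v, (v ∈ (openCluster (ends '' (↑(s₀) : Set ι)) (z)) ∨ v ∈ (openCluster (ends '' (↑((s₀)ᶜ)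 : Set ι)) (z))) ∧ v ∈ ends i)))
        rw [hQt]
        exact Prod.ext rfl ht
  rw [fiber_eq]
  have hPccell : ∀ t : Finset ι, t ∩ B = π → (P t)ᶜ = π ∪ (tᶜ \ B) := by
    intro t ht
    have hloc := zone_locality ends z s₀ t ht
    have hQt : (Finset.univ.filter (fun i : ι => ∃ v, (v ∈ (openCluster (ends '' (↑(t) : Set ι)) (z)) ∨ v ∈ (openCluster (ends '' (↑((t)ᶜ) : Set ι)) (z))) ∧ v ∈ ends i)) = B := by
      rw [hB]; ext i
      simp only [Finset.mem_filter, Finset.mem_univ, true_and, hloc.1, hloc.2]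
    have facts : ∀ i, (i ∈ π ↔ i ∈ t ∧ i ∈ B) := fun i => by rw [← ht]; exact Finset.mem_inter
    change (symmDiff t (Finset.univ.filter (fun i : ι => ∃ v, (v ∈ (openCluster (ends '' (↑(t) : Set ι)) (z)) ∨ v ∈ (openCluster (ends '' (↑((t)ᶜ) : Set ι)) (z))) ∧ v ∈ ends i)))ᶜ = π ∪ (tᶜ \ B)
    rw [hQt]
    ext i
    simp only [Finset.mem_compl, Finset.mem_symmDiff, Finset.mem_union, Finset.mem_sdiff]
    have := facts i
    have h2 : i ∈ π → i ∈ B := fun h => hπB h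
    tauto
  have hsum : ∑ t ∈ univ.filter (fun t : Finset ι => t ∩ B = π), F t * (G t - G (P t)ᶜ) =
      ∑ t ∈ univ.filter (fun t : Finset ι => t ∩ B = π), F t * G t -
        ∑ t ∈ univ.filter (fun t : Finset ι => t ∩ B = π), F t * G (π ∪ (tᶜ \ B)) := by
    rw [← Finset.sum_sub_distrib]
    refine Finset.sum_congr rfl fun t ht => ?_
    have ht' : t ∩ B = π := by simpa using ht
    rw [hPccell t ht']
    ring
  rw [hsum, sub_nonneg]
  exact cell_sum_mul_flip_le B π hπB F G hFm hGm

open Classical in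
/-- **Corollary (CW-PA ⟸ CROSS ≥ 0).**  If `0 ≤ Σ_{s∈S} f(C_x s)·(g(C_x((P_z s)ᶜ)) − g(C_x sᶜ))` then
`0 ≤ Σ_{s∈S} (f(C_x s) − f(C_x sᶜ))·(g(C_x s) − g(C_x sᶜ))`. [this work] -/
theorem cwpa_of_cross_nonneg (x : V) (f g : Set V → ℝ) (hf : Monotone f) (hg : Monotone g)
    (hc : 0 ≤ ∑ s ∈ univ.filter (fun s : Finset ι => z ∉ (openCluster (ends '' (↑(s) : Set ι)) (x)) ∧ z ∉ (openCluster (ends '' (↑(sᶜ) : Set ι)) (x))),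
        f (openCluster (ends '' (↑(s) : Set ι)) (x)) * (g (openCluster (ends '' (↑(((symmDiff (s) (Finset.univ.filter (fun i : ι => ∃ v, (v ∈ (openCluster (ends '' (↑(s) : Set ι)) (z)) ∨ v ∈ (openCluster (ends '' (↑((s)ᶜ) : Set ι)) (z))) ∧ v ∈ ends i))))ᶜ) : Set ι)) (x)) - g (openCluster (ends '' (↑(sᶜ) : Set ι)) (x)))) :
    0 ≤ ∑ s ∈ univ.filter (fun s : Finset ι => z ∉ (openCluster (ends '' (↑(s) : Set ι)) (x)) ∧ z ∉ (openCluster (ends '' (↑(sᶜ) : Set ι)) (x))),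
        (f (openCluster (ends '' (↑(s) : Set ι)) (x)) - f (openCluster (ends '' (↑(sᶜ) : Set ι)) (x))) * (g (openCluster (ends '' (↑(s) : Set ι)) (x)) - g (openCluster (ends '' (↑(sᶜ) : Set ι)) (x))) := by
  have hK := cross_le_cwpa ends z x f g hf hg
  set S : Finset (Finset ι) := univ.filter (fun s : Finset ι => z ∉ (openCluster (ends '' (↑(s) : Set ι)) (x)) ∧ z ∉ (openCluster (ends '' (↑(sᶜ) : Set ι)) (x))) with hS
  set F : Finset ι → ℝ := fun s => f (openCluster (ends '' (↑(s) : Set ι)) (x)) with hF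
  set G : Finset ι → ℝ := fun s => g (openCluster (ends '' (↑(s) : Set ι)) (x)) with hG
  have mem_S : ∀ s, s ∈ S ↔ z ∉ (openCluster (ends '' (↑(s) : Set ι)) (x)) ∧ z ∉ (openCluster (ends '' (↑(sᶜ) : Set ι)) (x)) := fun s => by simp [hS]
  have hcS : ∀ s ∈ S, sᶜ ∈ S := fun s hs => by
    rw [mem_S] at hs ⊢; rw [compl_compl]; exact ⟨hs.2, hs.1⟩
  have reindexC : ∀ Ψ : Finset ι → ℝ, ∑ s ∈ S, Ψ sᶜ = ∑ s ∈ S, Ψ s := by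
    intro Ψ
    refine Finset.sum_bij' (fun s _ => sᶜ) (fun s _ => sᶜ) ?_ ?_ ?_ ?_ ?_
    · intro s hs; exact hcS s hs
    · intro s hs; exact hcS s hs
    · intro s hs; exact compl_compl s
    · intro s hs; exact compl_compl s
    · intro s hs; rfl
  have hsym : ∑ s ∈ S, (F s - F sᶜ) * (G s - G sᶜ) = 2 * ∑ s ∈ S, F s * (G s - G sᶜ) := by
    have e : ∀ s, (F s - F sᶜ) * (G s - G sᶜ) = F s * (G s - G sᶜ) + F sᶜ * (G sᶜ - G s) := fun s => by ring
    simp only [e, Finset.sum_add_distrib]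
    have h2 : ∑ s ∈ S, F sᶜ * (G sᶜ - G s) = ∑ s ∈ S, F s * (G s - G sᶜ) := by
      have := reindexC (fun s => F s * (G s - G sᶜ))
      rw [← this]
      refine Finset.sum_congr rfl fun s _ => ?_
      simp only [compl_compl]
    rw [h2]; ring
  change 0 ≤ ∑ s ∈ S, (F s - F sᶜ) * (G s - G sᶜ)
  rw [hsym]
  change ∑ s ∈ S, F s * (g (openCluster (ends '' (↑(((symmDiff (s) (Finset.univ.filter (fun i : ι => ∃ v, (v ∈ (openCluster (ends '' (↑(s) : Set ι)) (z)) ∨ v ∈ (openCluster (ends '' (↑((s)ᶜ) : Set ι)) (z))) ∧ v ∈ ends i))))ᶜ) : Set ι)) (x)) - G sᶜ) ≤ ∑ s ∈ S, F s * (G s - G sᶜ) at hK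
  linarith [hK, hc]

end Coefficientwise

end Summit.CriticalPhenomena.PercolationContinuityZ3.Theorems
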